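import Summits.QuantumFields.BalabanUV.Beta.GAN24.WrecAtSlotRows
import Summits.QuantumFields.BalabanUV.Beta.GAN24.SrecAtSlotRowsFinal
import Summits.QuantumFields.BalabanUV.Beta.D1BFx.RoadEndRowPinned

/-!
# `BalabanUV.Beta.GAN24.WrecAtSlotRowsFinal` — binder row G-an2-4 ∕ (CONV-C), **THE W-SLOT ROWS (hW, hWall) OF THE `d = 3` COMB FAMILY AND ROAD FP's D1 LITERAL OF RECORD,
# AS FUNCTIONS OF THE TWO T₂ ROWS «T2Shape» ∧ «T2Drift» ALONE** (the S-side now hypothesis-free: the OWNER gan24-p1 g22's `SrecAtSlotRowsFinal`)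
NOT IN PRINT; OUR BOOKKEEPING (road-P2 chair of row G-an2-4, unit `b2b-balaban-gan24-p2` gen 35, crux team (2); CT-W socket capstone announced in [GAN24P2-G35-CTW];
the OWNER's RULING R-gan24p1-g22-1 «CT-W DESIGN v0» §0 ∕ §3 «END … → p2's W-β socket ⇒ (hW, hWall) of `WrecAt` ⇒ with `SrecAtSlotRowsFinal` the FOUR (E)-rows of
`exists_allScalesSeq_JsRowD1Pin_of_slots`»).  HONEST FRAMING (cell contract, verbatim): «discharging `BetaPertH` makes Bałaban's UV stability UNCONDITIONAL — a real
constructive-QFT result; it is NOT the continuum limit and NOT the Clay problem.»  HONEST DEPENDENCY (verbatim): «continuum YM on T⁴ ⇐ BetaPertH ∧ nine spine estimates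
(0/9 proved); BetaPertH ⇐ (D1) ∧ (D4) ∧ CAP+tail; G-an2-4 gates asym, D1 and NE2/3/4.»

WHAT ([folklore] composition BY NAME; 0 `def`, 0 cited facts, 0 `def … : Prop`, 0 sorry): my W-β socket `WrecAtSlotRows.hW_hWall_WrecAt_three_of_srecAt_allRoots` (✓ p308332) takes
the S-slot rows of the comb family in EXACTLY the shape the OWNER's `SrecAtSlotRowsFinal.exists_hS_hSall_SrecAt_three (hLc : 2 ≤ Lc) (hcE : cE = Lc^{3+1}) (cVH cΛ)` now PROVES
(✓ p309382); plugging it in: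
* §1 **`hW_hWall_WrecAt_three_of_T2`** (`Lc ≥ 2`, pin `cE = Lc^4`, every `cVH cΛ cE₂ cB`, every initial table `T`, every border `vh₂S`, every in-block root `r`): the W-slot rows
  `(hW, hWall)` of `unitW_j (WrecAt 3 Lc (toSite r) cE cVH cΛ cE₂ cB T vh₂S (mixFFAt (toSite r) Lc) j)` — uniform `VertexFamily₂` shape and geometric Cauchy rate — from the two T₂ rows
  «T2Shape» `hT₂` ∧ «T2Drift» `hT₂d` of `unitS₂_j (T2RecAt 3 Lc (toSite r) … j)` ALONE; **`hW_hWall_WrecAt_ctr_of_T2`** — the same at the centre root `ρ_c = toSite (ctrOff 4 Lc)` with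
  the D1 pins `(cE, cVH) = (Lc⁴, −Lc⁸∕2)`.
* §2 **`exists_allScalesSeq_JsRowD1Pin_of_T2`** (`Lc` odd, `Lc ≥ 2`, colour `N`): ROAD FP's D1 LITERAL OF RECORD `D1BFx.RoadEndRowPinned.exists_allScalesSeq_JsRowD1Pin_of_slots` with its
  FOUR row binders `hS hSall hW hWall` (and `hδS hδW hθS0 hθS1 hθW0 hθW1`) DISCHARGED down to the two T₂ rows at the literal's tables (`cΛ = 2∕Lc⁴`, `cE₂ = Lc⁸`, `cB = −Lc¹²∕4`,
  `T = (8N²)⁻¹ • wsym22 N`, `vh₂S = vh₂SAn1 Lc`, `mixFF = mixFFAt ρ_c Lc`): `∃ κ θ, 0 ≤ θ ∧ θ < 1 ∧ AllScalesSeq (j ↦ secondMoment (TbalOf Lc (JsRowD1Pin hLc N) j) μ ν) κ θ`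
  ⟸ «T2Shape» ∧ «T2Drift» of `unitS₂_j (T2RecAt 3 Lc ρ_c Lc⁴ (−Lc⁸∕2) (2∕Lc⁴) Lc⁸ (−Lc¹²∕4) ((8N²)⁻¹ • wsym22 N) (vh₂SAn1 Lc) (mixFFAt ρ_c Lc) j)`.
READING: after tonight the ENTIRE residual of the D1 literal of record on the G-an2-4 side is CT-W = the two T₂ rows of the comb tower at the centre root (the OWNER's design:
(R-HYB) + (R-CT); (F2) first test `HOME/b2b-balaban-gan24-p2/gen35/CT-W-F2-FIRST-TEST-v0.md`).  CONDITIONAL on `hT₂ ∕ hT₂d` — displayed, NOT discharged.  NOT «W-slot closed»,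
NOT «D1 closed»; NEVER «G-an2-4 closed» as (CONV-C); NOT `BetaPertH`, NOT continuum, NOT Clay; not in print.  2026-08-21.
-/

noncomputable section

open Finset
open scoped BigOperators
open Literature.MathematicalPhysics.QuantumFieldTheory
open Literature.MathematicalPhysics.QuantumFieldTheory.Balaban1983to89
open Literature.MathematicalPhysics.QuantumFieldTheory.Balaban1983to89.Beta
open RemainderConstAllScales (AllScalesSeq)
open ExpKernelCalculus (MKer VertexFamily₂)
open OneStepResolventKernel (Fib LocStencil)
open OneStepKernelFamily (TbalOf)
open AffineAveraging (box toSite)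
open AveragingContoursRooted (ctrOff ctrOff_mem_box)
open AveragingMixedJetTables (mixFFAt)
open WilsonVertex2Sym (wsym22)
open BalabanCompositeJets (LocStencil₂)
open Summit.QuantumFields.BalabanUV.Beta.HessKerDressedUnits (unitS unitW)
open Summit.QuantumFields.BalabanUV.Beta.SecondOrderUnits (unitS₂)
open Summit.QuantumFields.BalabanUV.Beta.SpineRooted (T2RecAt WrecAt)
open Summit.QuantumFields.BalabanUV.Beta.WardLocusRecursive (SrecAt)
open Summit.QuantumFields.BalabanUV.Beta.SecondOrderSocketIdentification (vh₂SAn1)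
open Summit.QuantumFields.BalabanUV.Beta.RowD1JointEnd (JsRowD1Pin)
open Summit.QuantumFields.BalabanUV.Beta.GAN24.CombesThomas (sfStep smStep)
open Summit.QuantumFields.BalabanUV.Beta.GAN24.WrecAtSlotRows (hW_hWall_WrecAt_three_of_srecAt_allRoots)
open Summit.QuantumFields.BalabanUV.Beta.GAN24.SrecAtSlotRowsFinal (exists_hS_hSall_SrecAt_three exists_hS_hSall_SrecAt_ctr)
open Summit.QuantumFields.BalabanUV.Beta.D1BFx.RoadEndRowPinned (exists_allScalesSeq_JsRowD1Pin_of_slots)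

namespace Summit.QuantumFields.BalabanUV.Beta.GAN24.WrecAtSlotRowsFinal

variable {Lc : ℕ} [NeZero Lc] {r : Fin (3 + 1) → ℕ}

/-! ## §1 (hW, hWall) of the comb family from the two T₂ rows alone -/

/-- NOT IN PRINT; OUR PROOF ATTEMPT ([folklore] composition: `WrecAtSlotRows.hW_hWall_WrecAt_three_of_srecAt_allRoots` ∘ the OWNER's `SrecAtSlotRowsFinal.exists_hS_hSall_SrecAt_three`).
**THE W-SLOT ROWS OF THE `d = 3` COMB FAMILY FROM «T2Shape» ∧ «T2Drift» ALONE** (`Lc ≥ 2`, pin `cE = Lc^{3+1}`, every `cVH cΛ cE₂ cB T vh₂S`, every in-block root): if the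
normalised T₂ tower `unitS₂_j (T2RecAt 3 Lc (toSite r) … j)` is a `LocStencil₂` family uniformly in `j` (`hT₂`) with geometrically Cauchy consecutive differences (`hT₂d`), then
`∃ Cw cW θW δW, 0 ≤ θW ∧ θW < 1 ∧ 0 < δW ∧ (∀ j, VertexFamily₂ (unitW_j (WrecAt … j)) Lc Cw δW) ∧ (∀ k j, VertexFamily₂ (unitW_{k+j} (WrecAt … (k+j)) − unitW_k (WrecAt … k)) Lc (cW·θW^k) δW)`.
The S-slot rows, the dressed K-rows, the multiplier ∕ mixed tables are TREE theorems (OWNER, asym1 ∘ road P1, an2, an1); ONLY the two T₂ rows are displayed (CT-W, OPEN). -/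
theorem hW_hWall_WrecAt_three_of_T2 (hLc : 2 ≤ Lc) {cE : ℝ} (hcE : cE = (Lc : ℝ) ^ (3 + 1)) (hr : r ∈ box (3 + 1) Lc) (cVH cΛ cE₂ cB : ℝ)
    (T : Fin 4 → Fin 4 → Fin 4 → Fin 4 → ℝ) (vh₂S : Fin (3 + 1) → (Fin (3 + 1) → ℤ) → Fin (3 + 1) → (Fin (3 + 1) → ℤ) → MKer (3 + 1) (Fib 3))
    {C₂ c₂ θ₂ δ₂ : ℝ}
    (hT₂ : ∀ j, LocStencil₂ (unitS₂ (sfStep Lc j) (smStep 3 Lc j)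
      (T2RecAt 3 Lc (toSite r) cE cVH cΛ cE₂ cB T vh₂S (mixFFAt (toSite r) Lc) j)) C₂ δ₂)
    (hT₂d : ∀ k j, LocStencil₂ (unitS₂ (sfStep Lc (k + j)) (smStep 3 Lc (k + j))
        (T2RecAt 3 Lc (toSite r) cE cVH cΛ cE₂ cB T vh₂S (mixFFAt (toSite r) Lc) (k + j)) -
      unitS₂ (sfStep Lc k) (smStep 3 Lc k) (T2RecAt 3 Lc (toSite r) cE cVH cΛ cE₂ cB T vh₂S (mixFFAt (toSite r) Lc) k)) (c₂ * θ₂ ^ k) δ₂)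
    (hδ₂ : 0 < δ₂) (hθ₂0 : 0 ≤ θ₂) (hθ₂1 : θ₂ < 1) :
    ∃ Cw cW θW δW : ℝ, 0 ≤ θW ∧ θW < 1 ∧ 0 < δW ∧
      (∀ j, VertexFamily₂ (unitW (sfStep Lc j) (smStep 3 Lc j)
        (WrecAt 3 Lc (toSite r) cE cVH cΛ cE₂ cB T vh₂S (mixFFAt (toSite r) Lc) j)) Lc Cw δW) ∧
      (∀ k j, VertexFamily₂ (unitW (sfStep Lc (k + j)) (smStep 3 Lc (k + j))
          (WrecAt 3 Lc (toSite r) cE cVH cΛ cE₂ cB T vh₂S (mixFFAt (toSite r) Lc) (k + j)) -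
        unitW (sfStep Lc k) (smStep 3 Lc k) (WrecAt 3 Lc (toSite r) cE cVH cΛ cE₂ cB T vh₂S (mixFFAt (toSite r) Lc) k)) Lc (cW * θW ^ k) δW) :=
  hW_hWall_WrecAt_three_of_srecAt_allRoots hLc hr cE cVH cΛ cE₂ cB T vh₂S (exists_hS_hSall_SrecAt_three hLc hcE cVH cΛ) hT₂ hT₂d hδ₂ hθ₂0 hθ₂1

/-- NOT IN PRINT; OUR PROOF ATTEMPT ([folklore] specialisation).  **THE SAME AT THE CENTRE ROOT `ρ_c = toSite (ctrOff (3+1) Lc)` AND THE D1 PINS `(cE, cVH) = (Lc⁴, −Lc⁸∕2)`**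
(`Lc ≥ 2`, every `cΛ cE₂ cB T vh₂S`). -/
theorem hW_hWall_WrecAt_ctr_of_T2 (hLc : 2 ≤ Lc) (cΛ cE₂ cB : ℝ) (T : Fin 4 → Fin 4 → Fin 4 → Fin 4 → ℝ)
    (vh₂S : Fin (3 + 1) → (Fin (3 + 1) → ℤ) → Fin (3 + 1) → (Fin (3 + 1) → ℤ) → MKer (3 + 1) (Fib 3)) {C₂ c₂ θ₂ δ₂ : ℝ}
    (hT₂ : ∀ j, LocStencil₂ (unitS₂ (sfStep Lc j) (smStep 3 Lc j)
      (T2RecAt 3 Lc (toSite (ctrOff (3 + 1) Lc)) ((Lc : ℝ) ^ 4) (-((Lc : ℝ) ^ 8 / 2)) cΛ cE₂ cB T vh₂S (mixFFAt (toSite (ctrOff (3 + 1) Lc)) Lc) j)) C₂ δ₂)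
    (hT₂d : ∀ k j, LocStencil₂ (unitS₂ (sfStep Lc (k + j)) (smStep 3 Lc (k + j))
        (T2RecAt 3 Lc (toSite (ctrOff (3 + 1) Lc)) ((Lc : ℝ) ^ 4) (-((Lc : ℝ) ^ 8 / 2)) cΛ cE₂ cB T vh₂S (mixFFAt (toSite (ctrOff (3 + 1) Lc)) Lc) (k + j)) -
      unitS₂ (sfStep Lc k) (smStep 3 Lc k)
        (T2RecAt 3 Lc (toSite (ctrOff (3 + 1) Lc)) ((Lc : ℝ) ^ 4) (-((Lc : ℝ) ^ 8 / 2)) cΛ cE₂ cB T vh₂S (mixFFAt (toSite (ctrOff (3 + 1) Lc)) Lc) k)) (c₂ * θ₂ ^ k) δ₂)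
    (hδ₂ : 0 < δ₂) (hθ₂0 : 0 ≤ θ₂) (hθ₂1 : θ₂ < 1) :
    ∃ Cw cW θW δW : ℝ, 0 ≤ θW ∧ θW < 1 ∧ 0 < δW ∧
      (∀ j, VertexFamily₂ (unitW (sfStep Lc j) (smStep 3 Lc j)
        (WrecAt 3 Lc (toSite (ctrOff (3 + 1) Lc)) ((Lc : ℝ) ^ 4) (-((Lc : ℝ) ^ 8 / 2)) cΛ cE₂ cB T vh₂S (mixFFAt (toSite (ctrOff (3 + 1) Lc)) Lc) j)) Lc Cw δW) ∧
      (∀ k j, VertexFamily₂ (unitW (sfStep Lc (k + j)) (smStep 3 Lc (k + j))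
          (WrecAt 3 Lc (toSite (ctrOff (3 + 1) Lc)) ((Lc : ℝ) ^ 4) (-((Lc : ℝ) ^ 8 / 2)) cΛ cE₂ cB T vh₂S (mixFFAt (toSite (ctrOff (3 + 1) Lc)) Lc) (k + j)) -
        unitW (sfStep Lc k) (smStep 3 Lc k)
          (WrecAt 3 Lc (toSite (ctrOff (3 + 1) Lc)) ((Lc : ℝ) ^ 4) (-((Lc : ℝ) ^ 8 / 2)) cΛ cE₂ cB T vh₂S (mixFFAt (toSite (ctrOff (3 + 1) Lc)) Lc) k)) Lc
        (cW * θW ^ k) δW) :=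
  hW_hWall_WrecAt_three_of_T2 hLc (cE := (Lc : ℝ) ^ 4) rfl (ctrOff_mem_box (by omega)) (-((Lc : ℝ) ^ 8 / 2)) cΛ cE₂ cB T vh₂S hT₂ hT₂d hδ₂ hθ₂0 hθ₂1

/-! ## §2 Road FP's D1 literal of record from the two T₂ rows alone -/

/-- NOT IN PRINT; OUR PROOF ATTEMPT ([folklore] composition: `D1BFx.RoadEndRowPinned.exists_allScalesSeq_JsRowD1Pin_of_slots` ∘ the OWNER's `exists_hS_hSall_SrecAt_ctr` ∘ §1).
**ROAD FP's D1 LITERAL OF RECORD MODULO CT-W ONLY** (`Lc` odd, `Lc ≥ 2`, colour `N`): the four row binders `hS hSall hW hWall` of `exists_allScalesSeq_JsRowD1Pin_of_slots` DISCHARGED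
down to the two T₂ rows «T2Shape» `hT₂` ∧ «T2Drift» `hT₂d` of the comb tower AT THE LITERAL's TABLES; conclusion VERBATIM the literal's:
`∃ κ θ, 0 ≤ θ ∧ θ < 1 ∧ AllScalesSeq (j ↦ secondMoment (TbalOf Lc (JsRowD1Pin hLc N) j) μ ν) κ θ`.  CONDITIONAL on `hT₂ ∕ hT₂d` (CT-W, OPEN); NOT «D1 closed». -/
theorem exists_allScalesSeq_JsRowD1Pin_of_T2 (hLc : Odd Lc) (hL2 : 2 ≤ Lc) (N : ℕ) {C₂ c₂ θ₂ δ₂ : ℝ}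
    (hT₂ : ∀ j, LocStencil₂ (unitS₂ (sfStep Lc j) (smStep 3 Lc j)
      (T2RecAt 3 Lc (toSite (ctrOff (3 + 1) Lc)) ((Lc : ℝ) ^ 4) (-((Lc : ℝ) ^ 8 / 2)) (2 / (Lc : ℝ) ^ 4) ((Lc : ℝ) ^ 8) (-((Lc : ℝ) ^ 12 / 4))
        ((8 * (N : ℝ) ^ 2)⁻¹ • wsym22 N) (vh₂SAn1 Lc) (mixFFAt (toSite (ctrOff (3 + 1) Lc)) Lc) j)) C₂ δ₂)
    (hT₂d : ∀ k j, LocStencil₂ (unitS₂ (sfStep Lc (k + j)) (smStep 3 Lc (k + j))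
        (T2RecAt 3 Lc (toSite (ctrOff (3 + 1) Lc)) ((Lc : ℝ) ^ 4) (-((Lc : ℝ) ^ 8 / 2)) (2 / (Lc : ℝ) ^ 4) ((Lc : ℝ) ^ 8) (-((Lc : ℝ) ^ 12 / 4))
          ((8 * (N : ℝ) ^ 2)⁻¹ • wsym22 N) (vh₂SAn1 Lc) (mixFFAt (toSite (ctrOff (3 + 1) Lc)) Lc) (k + j)) -
      unitS₂ (sfStep Lc k) (smStep 3 Lc k)
        (T2RecAt 3 Lc (toSite (ctrOff (3 + 1) Lc)) ((Lc : ℝ) ^ 4) (-((Lc : ℝ) ^ 8 / 2)) (2 / (Lc : ℝ) ^ 4) ((Lc : ℝ) ^ 8) (-((Lc : ℝ) ^ 12 / 4))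
          ((8 * (N : ℝ) ^ 2)⁻¹ • wsym22 N) (vh₂SAn1 Lc) (mixFFAt (toSite (ctrOff (3 + 1) Lc)) Lc) k)) (c₂ * θ₂ ^ k) δ₂)
    (hδ₂ : 0 < δ₂) (hθ₂0 : 0 ≤ θ₂) (hθ₂1 : θ₂ < 1) (μ ν : Fin 4) :
    ∃ κ θ : ℝ, 0 ≤ θ ∧ θ < 1 ∧ AllScalesSeq (fun j => B12Beta.secondMoment (TbalOf Lc (JsRowD1Pin hLc N) j) μ ν) κ θ := by
  obtain ⟨Cs, cS, θS, δS, hθS0, hθS1, hδS, hS, hSall⟩ := exists_hS_hSall_SrecAt_ctr (Lc := Lc) hL2 (2 / (Lc : ℝ) ^ 4)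
  obtain ⟨Cw, cW, θW, δW, hθW0, hθW1, hδW, hW, hWall⟩ := hW_hWall_WrecAt_ctr_of_T2 hL2 (2 / (Lc : ℝ) ^ 4) ((Lc : ℝ) ^ 8) (-((Lc : ℝ) ^ 12 / 4))
    ((8 * (N : ℝ) ^ 2)⁻¹ • wsym22 N) (vh₂SAn1 Lc) hT₂ hT₂d hδ₂ hθ₂0 hθ₂1
  exact exists_allScalesSeq_JsRowD1Pin_of_slots hLc hL2 N hS hSall hW hWall hδS hδW hθS0 hθS1 hθW0 hθW1 μ ν

end Summit.QuantumFields.BalabanUV.Beta.GAN24.WrecAtSlotRowsFinal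

end
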